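import Summits.AtomisticToContinuum.HydrodynamicLimit.Theorems.AntiMazurCoboundariesInfluenceLocalityAnchoredCoveringKinematics
import Summits.AtomisticToContinuum.HydrodynamicLimit.Theorems.AntiMazurCoboundariesInfluenceLocalityAnchoredCoveringDivergence

/-!
# Anchored covering, prelim 3: the first-infection lineage and its span

Prelim file of the registered stub `stub_anchoredCovering` (line `true-anchored-infection` of the
crux `InfluenceLocality`, stmt-AtomisticToContinuum-13916). The deterministic setting of the
anchored covering is bundled in the hypothesis structure `CoveringSetting d N k` (data and
standing hypotheses): a true world `Γ` and
the forecast world `F` of the range-`ρ` cluster (members `e m`, tagged member `m₀`, halo centre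
`x₀ = x_{e m₀}(0)`), both hard-sphere trajectories of diameter `ε` on the torus started from the
same states; members start within `ρ` of `x₀`, outsiders farther; on `[0, L]` true particles
are `U`-capped while within `ρ'` of `x₀` and forecast particles are `W`-capped (`U ≤ W`), and
the halo margin `ρ + U L < ρ'`.

* `CoveringSetting.member_disp`, `forecast_disp`, `outsider_far` — members never leave the halo,
  so they (and forecast particles) move at speed `≤ U` (`≤ W`); an outsider is at distance
  `≥ ρ - U t` from `x₀` at time `t`.
* `CoveringSetting.link_or_root` — the ANCHORED STEP: an infected member `m` (infection time
  `τ_m ≤ L`, anchor `P_m = x_{e m}(τ_m)`, its TRUE position) either touches an outsider, and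
  then `dist(P_m, x₀) ≥ ρ - U τ_m - ε`, or has a carrier `m'` infected earlier with
  `dist(P_m, P_{m'}) ≤ ε + W (τ_m - τ_{m'})` (one diameter at the contact, in whichever world it
  happens, plus the displacement of the capped carrier since its own anchor).
* `lineages`, **`CoveringSetting.exists_lineage`** (registered form `anchoredCovering_lineage`)
  — following carriers back from `m₀` gives lineages of every length `n ≤ K` as long as
  `(K + 2) ε + (U + W) L ≤ ρ`: a lineage of `n ≤ K` links spans at most
  `(n + 1) ε + (U + W) L < ρ` back from `x₀` (telescoping), so it cannot yet have reached an
  outsider.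
-/

namespace Summit.AtomisticToContinuum.HydrodynamicLimit.Theorems.TrueAnchoredInfection

open Set Filter Topology Function
open Literature.Analysis Literature.Analysis.FluidPDE

noncomputable section

variable {d : Type*} [Fintype d] {N k : ℕ} {ε L U W ρ ρ' : ℝ}
  {Γ : ℝ → Config N d (UnitAddTorus d)} {F : ℝ → Config k d (UnitAddTorus d)}
  {e : Fin k → Fin N} {m₀ : Fin k}

/-- The deterministic SETTING of the anchored covering (see the module docstring): the data of the
two worlds and the standing hypotheses, bundled. -/
structure CoveringSetting (d : Type*) [Fintype d] (N k : ℕ) where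
  /-- The sphere diameter. -/
  ε : ℝ
  /-- The horizon. -/
  L : ℝ
  /-- The absolute speed cap of true particles inside the halo. -/
  U : ℝ
  /-- The absolute speed cap of forecast particles. -/
  W : ℝ
  /-- The range: members start within `ρ` of the halo centre. -/
  ρ : ℝ
  /-- The halo radius. -/
  ρ' : ℝ
  /-- The true world. -/
  Γ : ℝ → Config N d (UnitAddTorus d)
  /-- The forecast world of the cluster. -/
  F : ℝ → Config k d (UnitAddTorus d)
  /-- The true labels of the members of the cluster. -/
  e : Fin k → Fin N
  /-- The tagged member (its initial true position is the halo centre). -/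
  m₀ : Fin k
  /-- The true world is a hard-sphere trajectory. -/
  hΓ : IsHardSphereTrajectory (Torus.geometry d) ε N Γ
  /-- The forecast world is a hard-sphere trajectory. -/
  hF : IsHardSphereTrajectory (Torus.geometry d) ε k F
  /-- Same initial states. -/
  h0 : ∀ m, F 0 m = Γ 0 (e m)
  /-- The labelling of the members is injective. -/
  he : Injective e
  /-- Positive diameter. -/
  hε : 0 < ε
  /-- Nonnegative true cap. -/
  hU : 0 ≤ U
  /-- The forecast cap dominates the true cap. -/
  hUW : U ≤ W
  /-- Halo margin. -/
  hmargin : ρ + U * L < ρ'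
  /-- Members start within `ρ` of the halo centre. -/
  hmem : ∀ m, Torus.euclidDist (Γ 0 (e m)).1 (Γ 0 (e m₀)).1 ≤ ρ
  /-- Outsiders start farther than `ρ`. -/
  hout : ∀ c, c ∉ Set.range e → ρ < Torus.euclidDist (Γ 0 c).1 (Γ 0 (e m₀)).1
  /-- True particles are `U`-capped while in the halo. -/
  hcapΓ : ∀ c, ∀ t ∈ Icc 0 L, Torus.euclidDist (Γ t c).1 (Γ 0 (e m₀)).1 < ρ' → ‖(Γ t c).2‖ ≤ U
  /-- Forecast particles are `W`-capped. -/
  hcapF : ∀ m, ∀ t ∈ Icc 0 L, ‖(F t m).2‖ ≤ W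

/-- Unguarded form: a speed bound on `[a, b)` bounds the displacement on `[a, b]`. -/
theorem disp_le_of_speed_le {γ : ℝ → Config N d (UnitAddTorus d)}
    (h : IsHardSphereTrajectory (Torus.geometry d) ε N γ) (j : Fin N)
    {a b V : ℝ} (H : ∀ t ∈ Ico a b, ‖(γ t j).2‖ ≤ V) :
    ∀ t ∈ Icc a b, Torus.euclidDist (γ t j).1 (γ a j).1 ≤ V * (t - a) :=
  disp_le_of_guarded_speed h j fun t ht _ => H t ht

namespace CoveringSetting

/-- Members move by at most `C.U t` from their initial position during `[0, C.L]` (guarded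
displacement: as long as the bound holds the member is in the halo, hence capped). -/
theorem member_disp_zero (C : CoveringSetting d N k) (m : Fin k) :
    ∀ t ∈ Icc 0 C.L, Torus.euclidDist (C.Γ t (C.e m)).1 (C.Γ 0 (C.e m)).1 ≤ C.U * (t - 0) := by
  refine disp_le_of_guarded_speed C.hΓ (C.e m) fun t ht hle => C.hcapΓ (C.e m) t ⟨ht.1, ht.2.le⟩ ?_
  calc Torus.euclidDist (C.Γ t (C.e m)).1 (C.Γ 0 (C.e C.m₀)).1
      ≤ Torus.euclidDist (C.Γ t (C.e m)).1 (C.Γ 0 (C.e m)).1 + Torus.euclidDist (C.Γ 0 (C.e m)).1 (C.Γ 0 (C.e C.m₀)).1 :=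
        torusDist_triangle _ _ _
    _ ≤ C.U * (t - 0) + C.ρ := add_le_add hle (C.hmem m)
    _ ≤ C.U * C.L + C.ρ := by rw [sub_zero]; gcongr; exacts [C.hU, ht.2.le]
    _ < C.ρ' := by linarith [C.hmargin]

/-- Members stay `C.U`-capped during `[0, C.L]`. -/
theorem member_speed (C : CoveringSetting d N k) (m : Fin k) {t : ℝ}
    (ht : t ∈ Icc 0 C.L) : ‖(C.Γ t (C.e m)).2‖ ≤ C.U := by
  refine C.hcapΓ (C.e m) t ht ?_
  calc Torus.euclidDist (C.Γ t (C.e m)).1 (C.Γ 0 (C.e C.m₀)).1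
      ≤ Torus.euclidDist (C.Γ t (C.e m)).1 (C.Γ 0 (C.e m)).1 + Torus.euclidDist (C.Γ 0 (C.e m)).1 (C.Γ 0 (C.e C.m₀)).1 :=
        torusDist_triangle _ _ _
    _ ≤ C.U * (t - 0) + C.ρ := add_le_add (C.member_disp_zero m t ht) (C.hmem m)
    _ ≤ C.U * C.L + C.ρ := by rw [sub_zero]; gcongr; exacts [C.hU, ht.2]
    _ < C.ρ' := by linarith [C.hmargin]

/-- Displacement of a member in the true world: `dist(x(t), x(s)) ≤ C.U (t - s)` for
`0 ≤ s ≤ t ≤ C.L`. -/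
theorem member_disp (C : CoveringSetting d N k) (m : Fin k) {s t : ℝ}
    (hs0 : 0 ≤ s) (hst : s ≤ t) (htL : t ≤ C.L) :
    Torus.euclidDist (C.Γ t (C.e m)).1 (C.Γ s (C.e m)).1 ≤ C.U * (t - s) :=
  disp_le_of_speed_le C.hΓ (C.e m) (fun _ hτ => C.member_speed m ⟨hs0.trans hτ.1, hτ.2.le.trans htL⟩)
    t ⟨hst, le_rfl⟩

/-- Displacement of a particle of the forecast world: `dist(x(t), x(s)) ≤ C.W (t - s)` for
`0 ≤ s ≤ t ≤ C.L`. -/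
theorem forecast_disp (C : CoveringSetting d N k) (m : Fin k) {s t : ℝ}
    (hs0 : 0 ≤ s) (hst : s ≤ t) (htL : t ≤ C.L) :
    Torus.euclidDist (C.F t m).1 (C.F s m).1 ≤ C.W * (t - s) :=
  disp_le_of_speed_le C.hF m (fun τ hτ => C.hcapF m τ ⟨hs0.trans hτ.1, hτ.2.le.trans htL⟩)
    t ⟨hst, le_rfl⟩

/-- An outsider is at distance `≥ C.ρ - C.U t` from the halo centre at time `t ∈ [0, C.L]`. -/
theorem outsider_far (C : CoveringSetting d N k) {c : Fin N}
    (hc : c ∉ Set.range C.e) {t : ℝ} (ht : t ∈ Icc 0 C.L) :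
    C.ρ - C.U * t ≤ Torus.euclidDist (C.Γ t c).1 (C.Γ 0 (C.e C.m₀)).1 := by
  have hρ : C.ρ < C.ρ' := by nlinarith [C.hmargin, C.hU, ht.1, ht.2]
  exact sub_le_dist_of_capped_in_halo C.hΓ c (C.Γ 0 (C.e C.m₀)).1 C.hU hρ (C.hcapΓ c)
    (C.hout c hc).le t ht

/-- **The anchored step.** An infected member `m` with `τ_m ≤ C.L` either touched an outsider —
then its anchor is far: `C.ρ - C.U τ_m - C.ε ≤ dist(P_m, x₀)` — or has a carrier `m'`, infected
strictly earlier, with `dist(P_m, P_{m'}) ≤ C.ε + C.W (τ_m - τ_{m'})`. -/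
theorem link_or_root (C : CoveringSetting d N k) {m : Fin k}
    (hinf : m ∈ infected C.Γ C.F C.e) (hL : infTime C.Γ C.F C.e m ≤ C.L) :
    C.ρ - C.U * infTime C.Γ C.F C.e m - C.ε ≤
        Torus.euclidDist (C.Γ (infTime C.Γ C.F C.e m) (C.e m)).1 (C.Γ 0 (C.e C.m₀)).1 ∨
      ∃ m', m' ∈ infected C.Γ C.F C.e ∧ infTime C.Γ C.F C.e m' < infTime C.Γ C.F C.e m ∧
        Torus.euclidDist (C.Γ (infTime C.Γ C.F C.e m) (C.e m)).1 (C.Γ (infTime C.Γ C.F C.e m') (C.e m')).1 ≤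
          C.ε + C.W * (infTime C.Γ C.F C.e m - infTime C.Γ C.F C.e m') := by
  set τ := infTime C.Γ C.F C.e m with hτ
  have hτ0 : 0 < τ := infTime_pos C.hΓ C.hF C.h0 hinf
  rcases exists_carrier C.hΓ C.hF C.h0 C.he hinf with ⟨c, hc, hcon⟩ | ⟨m', -, hinf', hlt, hcon⟩
  · -- root: contact with an outsider, which is far from the halo centre
    refine Or.inl ?_
    have hdist : Torus.euclidDist (C.Γ τ (C.e m)).1 (C.Γ τ c).1 = C.ε := by
      rw [← Torus.norm_geometry_sepVec]; exact (mem_contactSet.1 hcon).2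
    have hfar := C.outsider_far hc ⟨hτ0.le, hL⟩
    have htri : Torus.euclidDist (C.Γ τ c).1 (C.Γ 0 (C.e C.m₀)).1 ≤
        Torus.euclidDist (C.Γ τ c).1 (C.Γ τ (C.e m)).1 + Torus.euclidDist (C.Γ τ (C.e m)).1 (C.Γ 0 (C.e C.m₀)).1 :=
      torusDist_triangle _ _ _
    rw [Torus.euclidDist_comm (C.Γ τ c).1 (C.Γ τ (C.e m)).1, hdist] at htri
    linarith
  · refine Or.inr ⟨m', hinf', hlt, ?_⟩
    set τ' := infTime C.Γ C.F C.e m' with hτ'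
    have hτ'0 : 0 < τ' := infTime_pos C.hΓ C.hF C.h0 hinf'
    have hWU : C.U * (τ - τ') ≤ C.W * (τ - τ') :=
      mul_le_mul_of_nonneg_right C.hUW (sub_nonneg.2 hlt.le)
    rcases hcon with hcon | hcon
    · -- contact in the true world: the carrier moved at speed `≤ C.U ≤ C.W` since its anchor
      have hdist : Torus.euclidDist (C.Γ τ (C.e m)).1 (C.Γ τ (C.e m')).1 = C.ε := by
        rw [← Torus.norm_geometry_sepVec]; exact (mem_contactSet.1 hcon).2
      have hmove := C.member_disp m' hτ'0.le hlt.le hL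
      calc Torus.euclidDist (C.Γ τ (C.e m)).1 (C.Γ τ' (C.e m')).1
          ≤ Torus.euclidDist (C.Γ τ (C.e m)).1 (C.Γ τ (C.e m')).1 +
              Torus.euclidDist (C.Γ τ (C.e m')).1 (C.Γ τ' (C.e m')).1 := torusDist_triangle _ _ _
        _ ≤ C.ε + C.W * (τ - τ') := by rw [hdist]; exact add_le_add le_rfl (hmove.trans hWU)
    · -- contact in the forecast world: anchoring at both ends (fresh particles sit at their
      -- true positions), the carrier moved at speed `≤ C.W` in the forecast world
      have hdist : Torus.euclidDist (C.F τ m).1 (C.F τ m').1 = C.ε := by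
        rw [← Torus.norm_geometry_sepVec]; exact (mem_contactSet.1 hcon).2
      have hm : (C.Γ τ (C.e m)).1 = (C.F τ m).1 := fst_eq_of_mem_fresh C.hΓ C.hF mem_fresh_infTime hτ0
      have hm' : (C.Γ τ' (C.e m')).1 = (C.F τ' m').1 :=
        fst_eq_of_mem_fresh C.hΓ C.hF mem_fresh_infTime hτ'0
      have hmove := C.forecast_disp m' hτ'0.le hlt.le hL
      rw [hm, hm']
      calc Torus.euclidDist (C.F τ m).1 (C.F τ' m').1
          ≤ Torus.euclidDist (C.F τ m).1 (C.F τ m').1 + Torus.euclidDist (C.F τ m').1 (C.F τ' m').1 :=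
            torusDist_triangle _ _ _
        _ ≤ C.ε + C.W * (τ - τ') := by rw [hdist]; exact add_le_add le_rfl hmove

end CoveringSetting

/-! ## Lineages -/

/-- The LINEAGES of `n` links hanging from `m₀`: sequences of members `a 0 = m₀, a 1, …, a n`
(the values of `a` beyond `n` are irrelevant), each the carrier of the previous one — infected,
with strictly decreasing infection times and anchored steps
`dist(P_{a s}, P_{a (s+1)}) ≤ ε + W (τ_{a s} - τ_{a (s+1)})`. -/
def lineages (ε W : ℝ) (Γ : ℝ → Config N d (UnitAddTorus d)) (F : ℝ → Config k d (UnitAddTorus d))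
    (e : Fin k → Fin N) (m₀ : Fin k) (n : ℕ) : Set (ℕ → Fin k) :=
  {a | a 0 = m₀ ∧ (∀ s ≤ n, a s ∈ infected Γ F e) ∧
    ∀ s < n, infTime Γ F e (a (s + 1)) < infTime Γ F e (a s) ∧
      Torus.euclidDist (Γ (infTime Γ F e (a s)) (e (a s))).1
          (Γ (infTime Γ F e (a (s + 1))) (e (a (s + 1)))).1 ≤
        ε + W * (infTime Γ F e (a s) - infTime Γ F e (a (s + 1)))}

namespace Lineage

variable {n : ℕ} {a : ℕ → Fin k}

/-- Infection times strictly decrease along a lineage. -/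
theorem infTime_lt (h : a ∈ lineages ε W Γ F e m₀ n) {s s' : ℕ} (hss : s < s') (hs' : s' ≤ n) :
    infTime Γ F e (a s') < infTime Γ F e (a s) := by
  induction s', hss using Nat.le_induction with
  | base => exact (h.2.2 s (Nat.lt_of_succ_le hs')).1
  | succ s' hss ih =>
    exact (h.2.2 s' (Nat.lt_of_succ_le hs')).1.trans (ih (Nat.le_of_succ_le hs'))

/-- Infection times along a lineage are at most that of its head `m₀`. -/
theorem infTime_le_head (h : a ∈ lineages ε W Γ F e m₀ n) {s : ℕ} (hs : s ≤ n) :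
    infTime Γ F e (a s) ≤ infTime Γ F e m₀ := by
  rw [← h.1]
  rcases Nat.eq_zero_or_pos s with rfl | hpos
  · exact le_rfl
  · exact (infTime_lt h hpos hs).le

/-- The members of a lineage are pairwise distinct. -/
theorem injOn (h : a ∈ lineages ε W Γ F e m₀ n) {s s' : ℕ} (hs : s ≤ n) (hs' : s' ≤ n)
    (heq : a s = a s') : s = s' := by
  by_contra hne
  rcases Nat.lt_or_gt_of_ne hne with hlt | hlt
  · exact (infTime_lt h hlt hs').ne (by rw [heq])
  · exact (infTime_lt h hlt hs).ne (by rw [heq])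

/-- **Telescoping**: a lineage of `n` links spans at most `n ε + W (τ_{a 0} - τ_{a n})`. -/
theorem dist_le (h : a ∈ lineages ε W Γ F e m₀ n) {s : ℕ} (hs : s ≤ n) :
    Torus.euclidDist (Γ (infTime Γ F e (a 0)) (e (a 0))).1 (Γ (infTime Γ F e (a s)) (e (a s))).1 ≤
      s * ε + W * (infTime Γ F e (a 0) - infTime Γ F e (a s)) := by
  induction s with
  | zero => simp
  | succ s ih =>
    have hstep := (h.2.2 s (Nat.lt_of_succ_le hs)).2
    calc _ ≤ Torus.euclidDist (Γ (infTime Γ F e (a 0)) (e (a 0))).1 (Γ (infTime Γ F e (a s)) (e (a s))).1 +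
          Torus.euclidDist (Γ (infTime Γ F e (a s)) (e (a s))).1
            (Γ (infTime Γ F e (a (s + 1))) (e (a (s + 1)))).1 := torusDist_triangle _ _ _
      _ ≤ s * ε + W * (infTime Γ F e (a 0) - infTime Γ F e (a s)) +
          (ε + W * (infTime Γ F e (a s) - infTime Γ F e (a (s + 1)))) :=
            add_le_add (ih (Nat.le_of_succ_le hs)) hstep
      _ = _ := by push_cast; ring

/-- The trivial lineage (no link). -/
theorem zero (hinf : m₀ ∈ infected Γ F e) : (fun _ => m₀) ∈ lineages ε W Γ F e m₀ 0 :=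
  ⟨rfl, fun _ _ => hinf, fun _ hs => absurd hs (Nat.not_lt_zero _)⟩

/-- Extending a lineage by a carrier of its last member. -/
theorem extend (h : a ∈ lineages ε W Γ F e m₀ n) {m' : Fin k} (hinf' : m' ∈ infected Γ F e)
    (hlt : infTime Γ F e m' < infTime Γ F e (a n))
    (hlink : Torus.euclidDist (Γ (infTime Γ F e (a n)) (e (a n))).1 (Γ (infTime Γ F e m') (e m')).1 ≤
      ε + W * (infTime Γ F e (a n) - infTime Γ F e m')) :
    Function.update a (n + 1) m' ∈ lineages ε W Γ F e m₀ (n + 1) := by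
  have hold : ∀ s ≤ n, Function.update a (n + 1) m' s = a s := fun s hs =>
    Function.update_of_ne (by omega) _ _
  have hnew : Function.update a (n + 1) m' (n + 1) = m' := Function.update_self _ _ _
  refine ⟨by rw [hold 0 (Nat.zero_le _), h.1], fun s hs => ?_, fun s hs => ?_⟩
  · rcases Nat.lt_or_eq_of_le hs with hs | rfl
    · rw [hold s (Nat.le_of_lt_succ hs)]; exact h.2.1 s (Nat.le_of_lt_succ hs)
    · rw [hnew]; exact hinf'
  · rcases Nat.lt_or_eq_of_le (Nat.le_of_lt_succ hs) with hs | rfl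
    · rw [hold s hs.le, hold (s + 1) hs]; exact h.2.2 s hs
    · rw [hold s le_rfl, hnew]; exact ⟨hlt, hlink⟩

end Lineage

/-- **Existence of long lineages.** In a covering setting with `(K + 2) ε + (U + W) L ≤ ρ`, if
`m₀` is bad by time `L` then lineages of every length `n ≤ K` hang from `m₀`: a lineage of
`n ≤ K` links ending at a root would span, from `x₀` to the outsider's position, at most
`(n + 1) ε + W τ₀ + U τ₀ ≤ (K + 1) ε + (U + W) L < ρ - U τ`, contradicting `outsider_far`. -/
theorem CoveringSetting.exists_lineage (C : CoveringSetting d N k) {K : ℕ}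
    (hspan : ((K : ℝ) + 2) * C.ε + (C.U + C.W) * C.L ≤ C.ρ) (hbad : ∃ t ∈ Icc 0 C.L, C.Γ t (C.e C.m₀) ≠ C.F t C.m₀) :
    ∀ n ≤ K, ∃ a : ℕ → Fin k, a ∈ lineages C.ε C.W C.Γ C.F C.e C.m₀ n := by
  obtain ⟨t₀, ht₀, hne₀⟩ := hbad
  have hinf₀ : C.m₀ ∈ infected C.Γ C.F C.e := ⟨t₀, ht₀.1, hne₀⟩
  have hL₀ : infTime C.Γ C.F C.e C.m₀ ≤ C.L := (infTime_le ht₀.1 hne₀).trans ht₀.2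
  intro n
  induction n with
  | zero => exact fun _ => ⟨fun _ => C.m₀, Lineage.zero hinf₀⟩
  | succ n ih =>
    intro hn
    obtain ⟨a, ha⟩ := ih (Nat.le_of_succ_le hn)
    have hinf : a n ∈ infected C.Γ C.F C.e := ha.2.1 n le_rfl
    have hτL : infTime C.Γ C.F C.e (a n) ≤ C.L := (Lineage.infTime_le_head ha le_rfl).trans hL₀
    rcases C.link_or_root hinf hτL with hroot | ⟨m', hinf', hlt, hlink⟩
    · -- a rooted lineage of `n ≤ K - 1` links is too short to reach an outsider
      exfalso
      set τ₀ := infTime C.Γ C.F C.e C.m₀ with hτ₀def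
      set τ := infTime C.Γ C.F C.e (a n) with hτdef
      have hτ0 : 0 ≤ τ := infTime_nonneg
      have hτ0' : τ ≤ τ₀ := Lineage.infTime_le_head ha le_rfl
      have hW : 0 ≤ C.W := C.hU.trans C.hUW
      have hspan_n := Lineage.dist_le ha le_rfl
      rw [ha.1] at hspan_n
      -- the head anchor is within `C.U τ₀` of the halo centre
      have hhead : Torus.euclidDist (C.Γ τ₀ (C.e C.m₀)).1 (C.Γ 0 (C.e C.m₀)).1 ≤ C.U * (τ₀ - 0) :=
        C.member_disp C.m₀ le_rfl infTime_nonneg hL₀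
      have htri : Torus.euclidDist (C.Γ τ (C.e (a n))).1 (C.Γ 0 (C.e C.m₀)).1 ≤
          Torus.euclidDist (C.Γ τ (C.e (a n))).1 (C.Γ τ₀ (C.e C.m₀)).1 +
            Torus.euclidDist (C.Γ τ₀ (C.e C.m₀)).1 (C.Γ 0 (C.e C.m₀)).1 := torusDist_triangle _ _ _
      rw [Torus.euclidDist_comm (C.Γ τ (C.e (a n))).1 (C.Γ τ₀ (C.e C.m₀)).1] at htri
      have h1 : C.U * τ ≤ C.W * τ := mul_le_mul_of_nonneg_right C.hUW hτ0
      have h2 : C.W * τ₀ ≤ C.W * C.L := mul_le_mul_of_nonneg_left hL₀ hW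
      have h3 : C.U * τ₀ ≤ C.U * C.L := mul_le_mul_of_nonneg_left hL₀ C.hU
      have h4 : (n : ℝ) * C.ε ≤ ((K : ℝ) - 1) * C.ε := by
        have : (n : ℝ) + 1 ≤ K := by exact_mod_cast hn
        nlinarith [C.hε]
      nlinarith [hroot, hspan_n, hhead, htri, C.hε]
    · exact ⟨Function.update a (n + 1) m', Lineage.extend ha hinf' hlt hlink⟩

omit [Fintype d] in
/-- The infection time of a bad tagged member is at most the horizon. -/
theorem infTime_le_of_bad (hbad : ∃ t ∈ Icc 0 L, Γ t (e m₀) ≠ F t m₀) : infTime Γ F e m₀ ≤ L := by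
  obtain ⟨t₀, ht₀, hne₀⟩ := hbad
  exact (infTime_le ht₀.1 hne₀).trans ht₀.2

/-- **Registered prelim statement** (stub `stub_anchoredCovering`, lineages): in a covering setting
with `(K + 2) ε + (U + W) L ≤ ρ`, a tagged member bad by time `L` carries first-infection
lineages of every length `n ≤ K`. -/
theorem anchoredCovering_lineage : ∀ {d : Type} [Fintype d] {N k : ℕ} (C : CoveringSetting d N k) {K : ℕ}, ((K : ℝ) + 2) * C.ε + (C.U + C.W) * C.L ≤ C.ρ → (∃ t ∈ Set.Icc 0 C.L, C.Γ t (C.e C.m₀) ≠ C.F t C.m₀) → ∀ n ≤ K, ∃ a : ℕ → Fin k, a ∈ lineages C.ε C.W C.Γ C.F C.e C.m₀ n :=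
  fun C _ hspan hbad => C.exists_lineage hspan hbad

end

end Summit.AtomisticToContinuum.HydrodynamicLimit.Theorems.TrueAnchoredInfection
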